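import Mathlib
import Summits.FinalStateConjecture.FinalStateConjecture.Theorems.EIHFluxBalanceModulatedKerrHandoffDragDefectRicciExpansion
import Summits.FinalStateConjecture.FinalStateConjecture.Theorems.EIHFluxBalanceModulatedKerrHandoffDragDefectMinkowski
import Summits.FinalStateConjecture.FinalStateConjecture.Theorems.EIHFluxBalanceModulatedKerrHandoffDragDefectFields
import Summits.FinalStateConjecture.FinalStateConjecture.Theorems.EIHFluxBalanceModulatedKerrHandoffDragDefectKSDecay

/-!
# Route EIHFluxBalance — `ModulatedKerrHandoff`, stub `stub_dragDefect`: shell arithmetic and the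
# principal part of the far hole

Helper file for the crux `stmt-FinalStateConjecture-10167`
(`Summit.FinalStateConjecture.FinalStateConjecture.Theses.EIHFluxBalance.ModulatedKerrHandoff`),
line `overlap-modulation-second-iterate`, stub `stub_dragDefect`. Small inputs of the final
assembly of the drag-defect estimate:

* `add_bilinearComp`, `norm_AetaA_le`, `norm_drag_le` — pull-back of a sum; `‖η(A·,A·)‖ ≤ ‖A‖²`;
  `‖½η⁻¹c‖ ≤ ½‖c‖`;
* `jets_to_arith`, `shell_small` — conversion of the ball sup bounds `Nₘ = K(2/d)^{m+1}` into the
  shapes of the order count (`…DragDefectArith`), and numeric smallness on the buffer shell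
  (`32ε ≤ d ≤ D/8`);
* `far_hole_principal_le` — **the flat-space principal part of the Ricci form on the Hessian of the
  far hole is a sum of products**: for `Q = g_{M₂,0}(· − c₂)` and the constant field `η`, both
  Ricci-flat (`ricAt_kerr_sub`, `ricAt_const_minkowski`), the second-order expansion
  `dragDefect_ricci_expansion` with the inverse frozen to `η⁻¹` gives
  `|Σᵢ⟨bᵢ, ½(η⁻¹𝒦(D²Q bᵢ)(Y,Z) − η⁻¹𝒦(D²Q Y)(bᵢ,Z))⟩| ≤ 4((120‖DQ‖² + 12‖D²Q‖)‖Q − η‖ + 60‖DQ‖²)‖Y‖‖Z‖`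
  at a point `x` off both axes where `‖Q(x) − η‖ ≤ ½`;
* `abs_le_of_split` — the real-number bookkeeping `|R| ≤ B₁ + B₂ + B₃` from `|R − S| ≤ B₁`,
  `S = S₁ + S₂`, `|S₁| ≤ B₂`, `|S₂| ≤ B₃`.
-/

noncomputable section

-- `Summit.<S>.<S>.…` (single-problem summit, D-0017) trips core's duplicate-namespace linter.
set_option linter.dupNamespace false
set_option maxSynthPendingDepth 3

open Set Function Filter Metric ContinuousLinearMap Literature.Geometry.Lorentzian
  Literature.Geometry.Lorentzian.MetricCoord
open scoped Topology ContDiff RealInnerProductSpace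

namespace Summit.FinalStateConjecture.FinalStateConjecture.Theorems

namespace DragDefect

/-! ### Small algebraic and numeric facts -/

/-- Pull-back of a sum of forms. [folklore] -/
theorem add_bilinearComp (β₁ β₂ : E4 →L[ℝ] E4 →L[ℝ] ℝ) (L : E4 →L[ℝ] E4) :
    (β₁ + β₂).bilinearComp L L = β₁.bilinearComp L L + β₂.bilinearComp L L := by
  ext v w; simp only [bilinearComp_apply, _root_.add_apply]

/-- `‖η(A·, A·)‖ ≤ ‖A‖²`. [folklore] -/
theorem norm_AetaA_le (A : E4 →L[ℝ] E4) :
    ‖(ContinuousLinearMap.precomp ℝ A).comp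
        ((Minkowski.bilin : E4 →L[ℝ] E4 →L[ℝ] ℝ).comp A)‖ ≤ ‖A‖ ^ 2 := by
  refine opNorm_le_bound₂ _ (by positivity) fun v w ↦ ?_
  simp only [ContinuousLinearMap.comp_apply, ContinuousLinearMap.precomp_apply, Real.norm_eq_abs]
  calc |Minkowski.bilin (A v) (A w)| ≤ ‖A v‖ * ‖A w‖ := abs_minkowski_le _ _
    _ ≤ (‖A‖ * ‖v‖) * (‖A‖ * ‖w‖) :=
        mul_le_mul (le_opNorm _ _) (le_opNorm _ _) (norm_nonneg _) (by positivity)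
    _ = ‖A‖ ^ 2 * ‖v‖ * ‖w‖ := by ring

/-- `‖½ η⁻¹ c‖ ≤ ½ ‖c‖`. [folklore] -/
theorem norm_drag_le (c : E4 →L[ℝ] E4 →L[ℝ] ℝ) :
    ‖(2⁻¹ : ℝ) • ((Minkowski.bilin : E4 →L[ℝ] E4 →L[ℝ] ℝ).inverse.comp c)‖ ≤ 2⁻¹ * ‖c‖ := by
  rw [norm_smul, Real.norm_eq_abs, abs_of_pos (by norm_num : (0 : ℝ) < 2⁻¹)]
  gcongr
  calc _ ≤ ‖(Minkowski.bilin : E4 →L[ℝ] E4 →L[ℝ] ℝ).inverse‖ * ‖c‖ := opNorm_comp_le _ _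
    _ ≤ 1 * ‖c‖ := by gcongr; exact norm_minkowski_inverse_le
    _ = ‖c‖ := one_mul _

/-- **From ball sup bounds to the order count**: with `Nₘ = K (2/d)^{m+1}` and `b ≤ a d`, the three
drag-error jet bounds of `norm_iteratedFDeriv_dragError_le` are `≤ 18Ka²/d, 56Ka²/d², 184Ka²/d³`.
[folklore] -/
theorem jets_to_arith {K a b d : ℝ} (hK : 0 ≤ K) (ha : 0 ≤ a) (hb0 : 0 ≤ b) (hb : b ≤ a * d)
    (hd : 0 < d) :
    K * (2 / d) ^ (2 + 1) * b ^ 2 + 2 * (K * (2 / d) ^ (1 + 1)) * a * b + K * (2 / d) * a ^ 2 ≤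
      18 * K * a ^ 2 / d ∧
    K * (2 / d) ^ (3 + 1) * b ^ 2 + 3 * (K * (2 / d) ^ (2 + 1)) * a * b
      + 4 * (K * (2 / d) ^ (1 + 1)) * a ^ 2 ≤ 56 * K * a ^ 2 / d ^ 2 ∧
    K * (2 / d) ^ (4 + 1) * b ^ 2 + 4 * (K * (2 / d) ^ (3 + 1)) * a * b
      + 11 * (K * (2 / d) ^ (2 + 1)) * a ^ 2 ≤ 184 * K * a ^ 2 / d ^ 3 := by
  have hb2 : b ^ 2 ≤ (a * d) ^ 2 := pow_le_pow_left₀ hb0 hb 2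
  have hab : a * b ≤ a * (a * d) := mul_le_mul_of_nonneg_left hb ha
  have hd' : d ≠ 0 := hd.ne'
  refine ⟨?_, ?_, ?_⟩
  · calc _ ≤ K * (2 / d) ^ (2 + 1) * (a * d) ^ 2 + 2 * (K * (2 / d) ^ (1 + 1)) * (a * (a * d))
          + K * (2 / d) * a ^ 2 := by
          have e1 := mul_le_mul_of_nonneg_left hb2 (by positivity : 0 ≤ K * (2 / d) ^ (2 + 1))
          have e2 := mul_le_mul_of_nonneg_left hab (by positivity : 0 ≤ 2 * (K * (2 / d) ^ (1 + 1)))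
          nlinarith [e1, e2]
      _ = 18 * K * a ^ 2 / d := by norm_num only [div_pow]; field_simp; ring
  · calc _ ≤ K * (2 / d) ^ (3 + 1) * (a * d) ^ 2 + 3 * (K * (2 / d) ^ (2 + 1)) * (a * (a * d))
          + 4 * (K * (2 / d) ^ (1 + 1)) * a ^ 2 := by
          have e1 := mul_le_mul_of_nonneg_left hb2 (by positivity : 0 ≤ K * (2 / d) ^ (3 + 1))
          have e2 := mul_le_mul_of_nonneg_left hab (by positivity : 0 ≤ 3 * (K * (2 / d) ^ (2 + 1)))
          nlinarith [e1, e2]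
      _ = 56 * K * a ^ 2 / d ^ 2 := by norm_num only [div_pow]; field_simp; ring
  · calc _ ≤ K * (2 / d) ^ (4 + 1) * (a * d) ^ 2 + 4 * (K * (2 / d) ^ (3 + 1)) * (a * (a * d))
          + 11 * (K * (2 / d) ^ (2 + 1)) * a ^ 2 := by
          have e1 := mul_le_mul_of_nonneg_left hb2 (by positivity : 0 ≤ K * (2 / d) ^ (4 + 1))
          have e2 := mul_le_mul_of_nonneg_left hab (by positivity : 0 ≤ 4 * (K * (2 / d) ^ (3 + 1)))
          nlinarith [e1, e2]
      _ = 184 * K * a ^ 2 / d ^ 3 := by norm_num only [div_pow]; field_simp; ring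

/-- **Numeric smallness on the buffer shell**: with `32ε ≤ d`, `8d ≤ D`, `a ≤ ε/(2D)`, `K ≤ ε`:
`ε/d ≤ 1/32`, `ε/D ≤ 1/256`, `a² ≤ 1/16`, `8K/d ≤ 1/4`, `2K/D ≤ 1/16`, `K/D ≤ 1/16`,
`18Ka²/d ≤ 1/16`. [folklore] -/
theorem shell_small {ε d D a K : ℝ} (hd : 0 < d) (hD : 8 * d ≤ D) (hε : 32 * ε ≤ d) (hε0 : 0 ≤ ε)
    (ha0 : 0 ≤ a) (ha : a ≤ ε / (2 * D)) (hK : K ≤ ε) :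
    a ^ 2 ≤ 16⁻¹ ∧ 8 * K / d ≤ 4⁻¹ ∧ 2 * K / D ≤ 16⁻¹ ∧ K / D ≤ 16⁻¹ ∧
      18 * K * a ^ 2 / d ≤ 16⁻¹ := by
  have hD0 : 0 < D := by linarith
  have ha1 : a ≤ 4⁻¹ := by
    refine ha.trans ?_
    rw [div_le_iff₀ (by positivity)]; linarith
  have ha2 : a ^ 2 ≤ 16⁻¹ := by nlinarith
  refine ⟨ha2, ?_, ?_, ?_, ?_⟩
  · rw [div_le_iff₀ hd]; linarith
  · rw [div_le_iff₀ hD0]; linarith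
  · rw [div_le_iff₀ hD0]; linarith
  · rw [div_le_iff₀ hd]
    have : K * a ^ 2 ≤ ε * 16⁻¹ := mul_le_mul hK ha2 (by positivity) hε0
    nlinarith

/-! ### The principal part of the far hole -/

/-- **The flat-space principal part of the Ricci form on the Hessian of the far hole is a sum of
products** (second-order expansion for the Ricci-flat pair `(g_{M₂,0}(· − c₂), η)` with the inverse
frozen to `η⁻¹`). [cite: Kotschwar2014, §1.1 (5)–(8)] -/
theorem far_hole_principal_le (M₂ : ℝ) (c₂ : E4) {x : E4} (hρ : 0 < E4.spatialNorm (x - c₂))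
    (hx : 0 < E4.spatialNorm x)
    (hq : ‖Kerr.bilin M₂ 0 (x - c₂) - Minkowski.bilin‖ ≤ 2⁻¹) (Y Z : E4) :
    |∑ i, ⟪(EuclideanSpace.basisFun (Fin 4) ℝ) i, (2⁻¹ : ℝ) •
      ((Minkowski.bilin : E4 →L[ℝ] E4 →L[ℝ] ℝ).inverse (koszulOp
        ((fderiv ℝ (fderiv ℝ (fun z : E4 ↦ Kerr.bilin M₂ 0 (z - c₂))) x)
          ((EuclideanSpace.basisFun (Fin 4) ℝ) i)) Y Z)
      - (Minkowski.bilin : E4 →L[ℝ] E4 →L[ℝ] ℝ).inverse (koszulOp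
        ((fderiv ℝ (fderiv ℝ (fun z : E4 ↦ Kerr.bilin M₂ 0 (z - c₂))) x) Y)
          ((EuclideanSpace.basisFun (Fin 4) ℝ) i) Z))⟫| ≤
      4 * (((120 * ‖fderiv ℝ (fun z : E4 ↦ Kerr.bilin M₂ 0 (z - c₂)) x‖ ^ 2
        + 12 * ‖fderiv ℝ (fderiv ℝ (fun z : E4 ↦ Kerr.bilin M₂ 0 (z - c₂))) x‖)
          * ‖Kerr.bilin M₂ 0 (x - c₂) - Minkowski.bilin‖
        + 60 * ‖fderiv ℝ (fun z : E4 ↦ Kerr.bilin M₂ 0 (z - c₂)) x‖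
          * ‖fderiv ℝ (fun z : E4 ↦ Kerr.bilin M₂ 0 (z - c₂)) x‖) * ‖Y‖ * ‖Z‖) := by
  set η : E4 →L[ℝ] E4 →L[ℝ] ℝ := Minkowski.bilin with hη
  set Q : E4 → E4 →L[ℝ] E4 →L[ℝ] ℝ := fun z ↦ Kerr.bilin M₂ 0 (z - c₂) with hQ
  set σ : (E4 →L[ℝ] ℝ) →L[ℝ] E4 := η.inverse with hσ
  have hQm : IsMetricOn Q {y : E4 | 0 < E4.spatialNorm (y - c₂)} := isMetricOn_kerr_sub M₂ c₂
  have hRicQ : ricAt Q x = 0 := ricAt_kerr_sub M₂ c₂ hρ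
  have hRicη : ricAt (fun _ : E4 ↦ η) x = 0 := ricAt_const_minkowski hx
  have hησ : sharpAt (fun _ : E4 ↦ η) x = σ := rfl
  have hσ1 : ‖σ‖ ≤ 1 := norm_minkowski_inverse_le
  have hsQ : ‖sharpAt Q x‖ ≤ 2 := by
    have e : Q x = η + (Q x - η) := by abel
    rw [sharpAt, e]; exact norm_inverse_minkowski_add_le hq
  have hsη : ‖sharpAt (fun _ : E4 ↦ η) x‖ ≤ 2 := by rw [hησ]; exact hσ1.trans (by norm_num)
  have hT₂ : fderiv ℝ (fderiv ℝ Q) x - fderiv ℝ (fderiv ℝ (fun _ : E4 ↦ η)) x =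
      fderiv ℝ (fderiv ℝ Q) x := by
    ext v u w z; simp
  have hT₁ : fderiv ℝ Q x - fderiv ℝ (fun _ : E4 ↦ η) x = fderiv ℝ Q x := by
    ext v w z; simp
  have hDη : ‖fderiv ℝ (fun _ : E4 ↦ η) x‖ ≤ ‖fderiv ℝ Q x‖ := by
    simp only [fderiv_const_apply, norm_zero]; exact norm_nonneg _
  have h := dragDefect_ricci_expansion hQm (isMetricOn_const_minkowski hQm.isOpen) hρ (s := 2)
    (a₁ := ‖fderiv ℝ Q x‖) (a₂ := ‖fderiv ℝ (fderiv ℝ Q) x‖) hsQ hsη le_rfl hDη le_rfl σ Y Z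
  rw [hRicQ, hRicη, hησ, hT₂, hT₁] at h
  simp only [_root_.zero_apply, sub_self, zero_sub, abs_neg, norm_zero,
    mul_zero, zero_mul, add_zero, Fintype.card_fin, Nat.cast_ofNat] at h
  refine h.trans (le_of_eq ?_)
  ring

/-- Real bookkeeping: `|R| ≤ B₁ + B₂ + B₃` from `|R − S| ≤ B₁`, `S = S₁ + S₂`, `|S₁| ≤ B₂`, `|S₂| ≤ B₃`.
[folklore] -/
theorem abs_le_of_split {R S S₁ S₂ B₁ B₂ B₃ : ℝ} (h1 : |R - S| ≤ B₁) (h4 : S = S₁ + S₂)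
    (h2 : |S₁| ≤ B₂) (h3 : |S₂| ≤ B₃) : |R| ≤ B₁ + B₂ + B₃ := by
  have e1 : |R| ≤ |R - S| + |S| := by
    have := abs_add_le (R - S) S; rwa [sub_add_cancel] at this
  have e2 : |S| ≤ |S₁| + |S₂| := by rw [h4]; exact abs_add_le _ _
  linarith

/-- **Registered sub-goal form** (stub `dragDefect_abs_le_of_split` of the crux item) of
`abs_le_of_split`. [folklore] -/
theorem dragDefect_abs_le_of_split : ∀ {R S S₁ S₂ B₁ B₂ B₃ : ℝ}, |R - S| ≤ B₁ → S = S₁ + S₂ → |S₁| ≤ B₂ → |S₂| ≤ B₃ → |R| ≤ B₁ + B₂ + B₃ :=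
  fun h1 h4 h2 h3 ↦ abs_le_of_split h1 h4 h2 h3

end DragDefect

end Summit.FinalStateConjecture.FinalStateConjecture.Theorems

end
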